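import Summits.RiemannHypothesis.RiemannHypothesis.Theorems.RuelleBandExactFirstBandStubEvenTransfer
import Summits.RiemannHypothesis.RiemannHypothesis.Theorems.RuelleBandExactFirstBandStubEvenExpSum
import Literature.NumberTheory.LFunctions.WeilExplicitFormulaProofs
import Literature.NumberTheory.LFunctions.WeilLogLatticeComb
import HarnessLib

/-!
# M2 gap/second-level half — the negative index of the EVEN REAL Weil form is at most the number of off-line quadruples

pub-rhpf cell (M2 seat, generation 4).  HONEST FRAMING: long-odds MECHANISM SEARCH; no RH claims.

PROVED here (kernel-checked, RH-free), label PROVED + CITED: the finite-codimension form of the "≤" half of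
Bombieri's count of negative eigenvalues of Weil's quadratic functional in the even sector
(E. Bombieri, *Remarks on Weil's quadratic functional in the theory of prime numbers I*, Rend. Lincei (9) 11
(2000), Thm. 9, even part `K_E^+`: for a finite symmetric multiset of "zeros" the number of negative eigenvalues of
the even part equals the number of conjugate pairs `(γ, γ̄)` with `Re γ > 0`, i.e. of off-line quadruples).  For the
tree's Weil form `Q = weilQuadratic` of `ζ` itself (no truncation, full zero sum):

* (tree, `stub_evenTransfer_pairCoeff`) for an even real-valued `g` every zero-side coefficient is a square,
  `P_g(ρ) = ĝ(ρ)²`, and on the critical line `ĝ(ρ)` is real (`im_weilMellin_eq_zero_of_re_eq_half`), so on-line zeros contribute `m(ρ)|ĝ(ρ)|² ≥ 0`;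
* `im_weilMellin_eq_zero_of_quadrant`: by the symmetries `ĝ(1 − s) = ĝ(s)`, `ĝ(s̄) = conj ĝ(s)` the four zeros of an
  off-line quadruple `{ρ, ρ̄, 1 − ρ, 1 − ρ̄}` carry the values `x, x̄, x, x̄`; hence ONE real-linear condition
  `Im ĝ(ρ) = 0` per quadrant representative (`Re ρ > 1/2`, `Im ρ > 0`) makes EVERY term of `Re Q(g) = Σ m(ρ) Re ĝ(ρ)²`
  non-negative (`re_weilQuadratic_nonneg_of_im_zero`);
* `exists_combination_re_weilQuadratic_nonneg` (MAIN): if all quadrant off-line zeros lie in a finset `Z` and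
  `g₁, …, g_n` are even real Weil tests with `n > #Z`, some non-trivial REAL combination `G = Σ cᵢ gᵢ` has
  `Re Q(G) ≥ 0` — the even real Weil form has no negative definite real subspace of dimension `> #Z`
  (negative index `≤ K := #{ρ : ζ(ρ) = 0, Re ρ > 1/2, Im ρ > 0}`, for every window and every test space at once);
* `card_le_encard_quadrant_of_negative_family` (counted contrapositive): an `n`-dimensional family of even real tests
  on which `Re Q` is negative definite (over `ℝ`) forces at least `n` distinct quadrant off-line zeros.

Reading for the M2 seat (HOME/M2-ROUTE.md §10; corrects the HEURISTIC of §7.3): in the even real sector each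
off-line quadruple has signature `(1,1)`, not `(2,2)`; so "the second even level `ε₂^{ev}(a)` is `≥ 0` for every
window `a`" already follows from "at most ONE off-line quadruple" and is NOT visibly RH-strength, while two
independent negative even directions at a single window certify `K ≥ 2`.  Nothing here bounds the ground energy
`ε₁` from below; nothing implies or assumes RH.  [cite: Bombieri2000, Thm 9 (even part) and §10]
-/

noncomputable section

set_option linter.dupNamespace false  -- the mandated namespace repeats `RiemannHypothesis`

open Complex Filter Set MeasureTheory
open scoped Real Topology ComplexConjugate BigOperators

namespace Summit.RiemannHypothesis.RiemannHypothesis.Theorems.PfPersistenceM2NegIndex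

open Literature.NumberTheory.LFunctions
open Literature.NumberTheory.LFunctions.WeilConverse
open Literature.NumberTheory.LFunctions.ZetaZeros
open Summit.RiemannHypothesis.RiemannHypothesis.Theorems.RuelleBandExactFirstBand
  (stub_evenTransfer_conj_weilMellin stub_evenTransfer_pairCoeff weilMellin_one_sub_of_even)

/-! ## Transform symmetries of even real-valued test functions

Reused by name from the tree (`RuelleBandExactFirstBandStubEvenTransfer.lean`, `…StubEvenExpSum.lean`):
`stub_evenTransfer_conj_weilMellin : conj ĝ(s) = ĝ(1 − s̄)`, `stub_evenTransfer_pairCoeff : P_g(ρ) = ĝ(ρ)·ĝ(ρ)`,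
`weilMellin_one_sub_of_even : ĝ(1 − s) = ĝ(s)`. -/

/-- `ĝ(s̄) = conj ĝ(s)` for even real `g`. [folklore] -/
theorem weilMellin_conj {g : ℝ → ℂ} (heven : ∀ t : ℝ, g (-t) = g t)
    (hreal : ∀ t : ℝ, (g t).im = 0) (s : ℂ) : weilMellin g (conj s) = conj (weilMellin g s) := by
  rw [stub_evenTransfer_conj_weilMellin heven hreal, weilMellin_one_sub_of_even heven]

/-- On the critical line the transform of an even real `g` is REAL: `Re s = 1/2 → Im ĝ(s) = 0`
(there `1 − s̄ = s`). [cite: Bombieri2000, §3 eq. (3.2)] -/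
theorem im_weilMellin_eq_zero_of_re_eq_half {g : ℝ → ℂ} (heven : ∀ t : ℝ, g (-t) = g t)
    (hreal : ∀ t : ℝ, (g t).im = 0) {s : ℂ} (hs : s.re = 1 / 2) : (weilMellin g s).im = 0 := by
  have h1 : 1 - conj s = s := by
    apply Complex.ext
    · simp only [Complex.sub_re, Complex.one_re, Complex.conj_re, hs]; norm_num
    · simp only [Complex.sub_im, Complex.one_im, Complex.conj_im]; ring
  have h := stub_evenTransfer_conj_weilMellin heven hreal s
  rw [h1] at h
  exact Complex.conj_eq_iff_im.1 h

/-! ## One real condition per off-line quadruple -/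

/-- **Symmetry transport.**  Let `g` be even and real-valued and let `Z ⊆ ℂ` contain every non-trivial zero of `ζ`
in the open quadrant `Re ρ > 1/2`, `Im ρ > 0`.  If `Im ĝ` vanishes on `Z`, then `Im ĝ(ρ) = 0` at EVERY non-trivial
zero `ρ`: on the line by `im_weilMellin_eq_zero_of_re_eq_half`, and off the line because one of
`ρ, ρ̄, 1 − ρ, 1 − ρ̄` lies in the quadrant and `ĝ` takes the values `x, x̄, x, x̄` there. [cite: Bombieri2000, Thm 9] -/
theorem im_weilMellin_eq_zero_of_quadrant {g : ℝ → ℂ} (heven : ∀ t : ℝ, g (-t) = g t)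
    (hreal : ∀ t : ℝ, (g t).im = 0) {Z : Set ℂ}
    (hZ : ∀ ρ ∈ riemannZetaNontrivialZeros, 1 / 2 < ρ.re → 0 < ρ.im → ρ ∈ Z)
    (hvan : ∀ ρ ∈ Z, (weilMellin g ρ).im = 0) {ρ : ℂ} (hρ : ρ ∈ riemannZetaNontrivialZeros) :
    (weilMellin g ρ).im = 0 := by
  have him : ρ.im ≠ 0 := riemannZetaNontrivialZeros.im_ne_zero hρ
  rcases lt_trichotomy ρ.re (1 / 2) with hlt | heq | hgt
  · rcases lt_or_gt_of_ne him with hneg | hpos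
    · -- `Re ρ < 1/2`, `Im ρ < 0`: the representative is `1 − ρ`, where `ĝ(1 − ρ) = ĝ(ρ)`
      have hmem : 1 - ρ ∈ riemannZetaNontrivialZeros := by
        simpa using riemannZetaNontrivialZeros.one_sub_conj_mem (riemannZetaNontrivialZeros.conj_mem hρ)
      have h1 := hvan _ (hZ _ hmem (by simp only [Complex.sub_re, Complex.one_re]; linarith)
        (by simp only [Complex.sub_im, Complex.one_im]; linarith))
      rwa [weilMellin_one_sub_of_even heven] at h1
    · -- `Re ρ < 1/2`, `Im ρ > 0`: the representative is `1 − ρ̄`, where `ĝ(1 − ρ̄) = conj ĝ(ρ)`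
      have hmem := riemannZetaNontrivialZeros.one_sub_conj_mem hρ
      have h1 := hvan _ (hZ _ hmem (by simp only [Complex.sub_re, Complex.one_re, Complex.conj_re]; linarith)
        (by simp only [Complex.sub_im, Complex.one_im, Complex.conj_im]; linarith))
      rw [← stub_evenTransfer_conj_weilMellin heven hreal, Complex.conj_im] at h1
      linarith
  · exact im_weilMellin_eq_zero_of_re_eq_half heven hreal heq
  · rcases lt_or_gt_of_ne him with hneg | hpos
    · -- `Re ρ > 1/2`, `Im ρ < 0`: the representative is `ρ̄`, where `ĝ(ρ̄) = conj ĝ(ρ)`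
      have hmem := riemannZetaNontrivialZeros.conj_mem hρ
      have h1 := hvan _ (hZ _ hmem (by simp only [Complex.conj_re]; linarith)
        (by simp only [Complex.conj_im]; linarith))
      rw [weilMellin_conj heven hreal, Complex.conj_im] at h1
      linarith
    · exact hvan _ (hZ _ hρ hgt hpos)

/-- **Termwise positivity.**  For an even real Weil test `g` with `Im ĝ(ρ) = 0` at every non-trivial zero,
`Re Q(g) = Σ_ρ m(ρ) (Re ĝ(ρ))² ≥ 0`: `Q(g)` is the zero form `Σ m(ρ) P_g(ρ)` (uniqueness of the limit of the
symmetric partial sums: `hasWeilZeroSide_zeroForm` and the PROVED explicit formula `explicit_formula_holds`),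
the series converges absolutely, and each term is `m(ρ) ĝ(ρ)²` with `ĝ(ρ)` real. [cite: Bombieri2000, Thm 1] -/
theorem re_weilQuadratic_nonneg_of_im_zero {g : ℝ → ℂ} (hg : IsWeilTest g)
    (heven : ∀ t : ℝ, g (-t) = g t) (hreal : ∀ t : ℝ, (g t).im = 0)
    (hvan : ∀ ρ ∈ riemannZetaNontrivialZeros, (weilMellin g ρ).im = 0) :
    0 ≤ (weilQuadratic g).re := by
  have hQ : zeroForm g = weilQuadratic g :=
    tendsto_nhds_unique (hasWeilZeroSide_zeroForm hg) (explicit_formula_holds (hg.weilConv hg.weilReflect))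
  rw [← hQ, zeroForm, Complex.re_tsum (summable_pairCoeff hg)]
  refine tsum_nonneg fun ρ ↦ ?_
  have hsq : pairCoeff g ρ = (((weilMellin g (ρ : ℂ)).re ^ 2 : ℝ) : ℂ) := by
    rw [stub_evenTransfer_pairCoeff heven hreal]
    apply Complex.ext
    · rw [Complex.ofReal_re, Complex.mul_re, hvan ρ ρ.2, sq]; ring
    · rw [Complex.ofReal_im, Complex.mul_im, hvan ρ ρ.2]; ring
  have hm : (0 : ℝ) ≤ (riemannZetaZeroOrder (ρ : ℂ) : ℝ) := by
    have h0 : (0 : ℤ) ≤ riemannZetaZeroOrder (ρ : ℂ) :=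
      le_trans zero_le_one (riemannZetaNontrivialZeros.one_le_order ρ.2)
    exact_mod_cast h0
  rw [hsq]
  simp only [Complex.mul_re, Complex.ofReal_re, Complex.ofReal_im, Complex.intCast_re, Complex.intCast_im,
    mul_zero, sub_zero]
  exact mul_nonneg hm (sq_nonneg _)

/-! ## The negative index bound -/

/-- **MAIN (negative index of the even real Weil form ≤ number of off-line quadruples).**  Let the finset `Z`
contain every non-trivial zero of `ζ` with `Re ρ > 1/2` and `Im ρ > 0`, and let `(gᵢ)_{i ∈ ι}` be even real-valued
Weil test functions with `#ι > #Z`.  Then some non-trivial REAL combination `G = Σ cᵢ gᵢ` has `Im Ĝ = 0` at every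
non-trivial zero and `Re Q(G) ≥ 0`.  Proof: the `ℝ`-linear map `c ↦ (Im Ĝ_c(ρ))_{ρ ∈ Z}` from `ℝ^ι` to `ℝ^Z`
has a non-trivial kernel by dimension count (`LinearMap.ker_ne_bot_of_finrank_lt`); conclude with
`im_weilMellin_eq_zero_of_quadrant` and `re_weilQuadratic_nonneg_of_im_zero`.  RH-free; under `¬RH` with
finitely many exceptions this is the "≤" half of Bombieri's count, for the untruncated form.
[cite: Bombieri2000, Thm 9 (even part)] -/
theorem exists_combination_re_weilQuadratic_nonneg {ι : Type*} [Fintype ι] (Z : Finset ℂ)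
    (hZ : ∀ ρ ∈ riemannZetaNontrivialZeros, 1 / 2 < ρ.re → 0 < ρ.im → ρ ∈ Z)
    (hcard : Z.card < Fintype.card ι) (g : ι → ℝ → ℂ) (htest : ∀ i, IsWeilTest (g i))
    (heven : ∀ i (t : ℝ), g i (-t) = g i t) (hreal : ∀ i (t : ℝ), (g i t).im = 0) :
    ∃ c : ι → ℝ, c ≠ 0 ∧
      (∀ ρ ∈ riemannZetaNontrivialZeros, (weilMellin (fun t : ℝ ↦ ∑ i, (c i : ℂ) * g i t) ρ).im = 0) ∧
      0 ≤ (weilQuadratic (fun t : ℝ ↦ ∑ i, (c i : ℂ) * g i t)).re := by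
  classical
  -- the real-linear conditions `Im Ĝ_c(ρ) = 0`, `ρ ∈ Z`
  let L : (ι → ℝ) →ₗ[ℝ] (Z → ℝ) :=
    { toFun := fun c ρ ↦ ∑ i, c i * (weilMellin (g i) (ρ : ℂ)).im
      map_add' := by
        intro c d
        funext ρ
        simp only [Pi.add_apply, add_mul, Finset.sum_add_distrib]
      map_smul' := by
        intro r c
        funext ρ
        simp only [Pi.smul_apply, smul_eq_mul, RingHom.id_apply, Finset.mul_sum, mul_assoc] }
  have hker : LinearMap.ker L ≠ ⊥ :=
    LinearMap.ker_ne_bot_of_finrank_lt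
      (by simpa [Module.finrank_fintype_fun_eq_card, Fintype.card_coe] using hcard)
  obtain ⟨c, hc, hc0⟩ := Submodule.exists_mem_ne_zero_of_ne_bot hker
  refine ⟨c, hc0, ?_⟩
  -- the combination `G = Σ cᵢ gᵢ` is an even real Weil test with `Ĝ = Σ cᵢ ĝᵢ`
  have hGtest : IsWeilTest (fun t : ℝ ↦ ∑ i, (c i : ℂ) * g i t) :=
    isWeilTest_finset_sum Finset.univ fun i _ ↦ (htest i).const_mul (c i)
  have hGeven : ∀ t : ℝ, (fun t : ℝ ↦ ∑ i, (c i : ℂ) * g i t) (-t) = (fun t : ℝ ↦ ∑ i, (c i : ℂ) * g i t) t :=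
    fun t ↦ by simp only [heven]
  have hGreal : ∀ t : ℝ, ((fun t : ℝ ↦ ∑ i, (c i : ℂ) * g i t) t).im = 0 := fun t ↦ by
    simp [Complex.im_sum, Complex.mul_im, hreal]
  have hGmellin : ∀ s : ℂ, weilMellin (fun t : ℝ ↦ ∑ i, (c i : ℂ) * g i t) s = ∑ i, (c i : ℂ) * weilMellin (g i) s :=
    fun s ↦ by
      have h := weilMellin_finset_sum Finset.univ (f := fun i (t : ℝ) ↦ (c i : ℂ) * g i t)
        (fun i _ ↦ (htest i).const_mul (c i)) s
      simpa only [weilMellin_const_mul] using h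
  -- `Im Ĝ` vanishes on `Z` (kernel condition), hence at every non-trivial zero
  have hvanZ : ∀ ρ ∈ (Z : Set ℂ), (weilMellin (fun t : ℝ ↦ ∑ i, (c i : ℂ) * g i t) ρ).im = 0 := by
    intro ρ hρ
    have hρ' : ρ ∈ Z := by simpa using hρ
    have h := congrFun (LinearMap.mem_ker.1 hc) ⟨ρ, hρ'⟩
    have h' : ∑ i, c i * (weilMellin (g i) ρ).im = 0 := by simpa [L] using h
    rw [hGmellin, Complex.im_sum]
    simpa [Complex.mul_im] using h'
  have hZ' : ∀ ρ ∈ riemannZetaNontrivialZeros, 1 / 2 < ρ.re → 0 < ρ.im → ρ ∈ (Z : Set ℂ) :=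
    fun ρ hρ h1 h2 ↦ by simpa using hZ ρ hρ h1 h2
  have hvan : ∀ ρ ∈ riemannZetaNontrivialZeros, (weilMellin (fun t : ℝ ↦ ∑ i, (c i : ℂ) * g i t) ρ).im = 0 :=
    fun ρ hρ ↦ im_weilMellin_eq_zero_of_quadrant hGeven hGreal hZ' hvanZ hρ
  exact ⟨hvan, re_weilQuadratic_nonneg_of_im_zero hGtest hGeven hGreal hvan⟩

/-- **Counted contrapositive.**  If `(gᵢ)_{i ∈ ι}` are even real Weil tests on whose real span `Re Q` is NEGATIVE
DEFINITE (`Re Q(Σ cᵢ gᵢ) < 0` for every real `c ≠ 0`), then `ζ` has at least `#ι` distinct zeros in the open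
quadrant `Re ρ > 1/2`, `Im ρ > 0` (as an `ℕ∞`-cardinality: the set is infinite or has `≥ #ι` elements).  With
`#ι = 2`: two independent negative even directions at one window certify TWO off-line quadruples.
[cite: Bombieri2000, Thm 9 (even part)] -/
theorem card_le_encard_quadrant_of_negative_family {ι : Type*} [Fintype ι] (g : ι → ℝ → ℂ)
    (htest : ∀ i, IsWeilTest (g i)) (heven : ∀ i (t : ℝ), g i (-t) = g i t)
    (hreal : ∀ i (t : ℝ), (g i t).im = 0)
    (hneg : ∀ c : ι → ℝ, c ≠ 0 → (weilQuadratic (fun t : ℝ ↦ ∑ i, (c i : ℂ) * g i t)).re < 0) :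
    (Fintype.card ι : ℕ∞) ≤ {ρ : ℂ | ρ ∈ riemannZetaNontrivialZeros ∧ 1 / 2 < ρ.re ∧ 0 < ρ.im}.encard := by
  by_contra hlt
  rw [not_le] at hlt
  have hfin : {ρ : ℂ | ρ ∈ riemannZetaNontrivialZeros ∧ 1 / 2 < ρ.re ∧ 0 < ρ.im}.Finite :=
    Set.encard_lt_top_iff.1 (hlt.trans (ENat.coe_lt_top _))
  rw [hfin.encard_eq_coe_toFinset_card, Nat.cast_lt] at hlt
  obtain ⟨c, hc0, -, hQ⟩ := exists_combination_re_weilQuadratic_nonneg hfin.toFinset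
    (fun ρ hρ h1 h2 ↦ hfin.mem_toFinset.2 ⟨hρ, h1, h2⟩) hlt g htest heven hreal
  exact absurd (hneg c hc0) (not_lt.2 hQ)

end Summit.RiemannHypothesis.RiemannHypothesis.Theorems.PfPersistenceM2NegIndex

end
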